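import Summits.Ventures.DiscreteObjects.UnitDistance.PlaneDeBruijnErdos
import HarnessLib

/-!
# Summary corollaries for target (U): a 5-chromatic finite unit-distance graph EXISTS (kernel), and `χ(ℝ²) ∈ {5, 6, 7}`

Framing (verbatim for the cell): lottery ticket; floor = certified bounds/negative ranges.

Two one-step consequences of `PlaneLowerBoundFive` / `PlaneUpperBoundSeven` / `PlaneDeBruijnErdos` recorded in the census vocabulary of
`SixChromatic.lean`: (i) `fiveChromaticUnitDistanceGraphExists` — the statement one level below target (U) (`∃` a finite unit-distance graph, injectively
realised, that is not 4-colourable) is a THEOREM (de Grey 2018; here from `plane_not_colorable_four` and de Bruijn–Erdős, so the witness is not named —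
de Grey's explicit 1581-vertex graph is not needed for the statement); (ii) `chromaticNumber_plane_cases` — `χ(ℝ²) = 5 ∨ χ(ℝ²) = 6 ∨ χ(ℝ²) = 7`, with
target (U) equivalent to the last two cases (`sixChromatic_iff`).  Seat udg g9.
-/

namespace Summit.Ventures.DiscreteObjects.UnitDistance

open SimpleGraph

/-- ONE LEVEL BELOW TARGET (U), AS A THEOREM: there is a finite unit-distance graph in the plane (vertex type `Fin n`, injective realisation)
that is not 4-colourable. -/
theorem fiveChromaticUnitDistanceGraphExists :
    ∃ (n : ℕ) (G : SimpleGraph (Fin n)) (p : Fin n → EuclideanSpace ℝ (Fin 2)), IsUnitDistanceRealisation G p ∧ ¬ G.Colorable 4 := by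
  by_contra h
  apply plane_not_colorable_four
  apply colorable_of_forall_finset
  intro s
  by_contra hs
  exact h (exists_realisation_of_finset s hs)

/-- `χ(ℝ²) ∈ {5, 6, 7}` (kernel), the middle value being exactly target (U). -/
theorem chromaticNumber_plane_cases :
    planeUnitDistanceGraph.chromaticNumber = 5 ∨ planeUnitDistanceGraph.chromaticNumber = 6 ∨
      planeUnitDistanceGraph.chromaticNumber = 7 := by
  obtain ⟨h5, h7⟩ := plane_chromaticNumber_bounds
  have hne : planeUnitDistanceGraph.chromaticNumber ≠ ⊤ := by
    intro htop; rw [htop] at h7; exact absurd h7 (by decide)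
  obtain ⟨m, hm⟩ := ENat.ne_top_iff_exists.mp hne
  rw [← hm] at h5 h7 ⊢
  have h5' : 5 ≤ m := by exact_mod_cast h5
  have h7' : m ≤ 7 := by exact_mod_cast h7
  interval_cases m
  · exact Or.inl rfl
  · exact Or.inr (Or.inl rfl)
  · exact Or.inr (Or.inr rfl)

/-- Target (U) holds iff `χ(ℝ²)` is `6` or `7`. -/
theorem sixChromatic_iff_cases :
    SixChromaticUnitDistanceGraphExists ↔
      planeUnitDistanceGraph.chromaticNumber = 6 ∨ planeUnitDistanceGraph.chromaticNumber = 7 := by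
  rw [sixChromatic_iff]
  rcases chromaticNumber_plane_cases with h | h | h <;> rw [h] <;> decide

end Summit.Ventures.DiscreteObjects.UnitDistance
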